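import Mathlib
import Summits.AtomisticToContinuum.FouriersLaw.Theses.MatthiessenLadder
import Summits.AtomisticToContinuum.FouriersLaw.Theorems.OddSectorIrreversibilityBoundedResponseConvergesStubPositiveConductance
import Summits.AtomisticToContinuum.FouriersLaw.Theorems.FourierGreenKuboFourierFiniteResponseOfUnique

/-!
# Stub `stub_positiveConductance_top` of line `registered`
# (crux stmt-AtomisticToContinuum-12776, `MatthiessenLadder.PrefixIncrementBounds`)

**Positive conductance of the top rung of the prefix ladder.** For `ω₂, lam, β, γ > 0`, `T > 0` and
`2 ≤ N ≤ k`, every response coefficient `D` of the prefix cell chain `cellChain ω₂ lam β γ (· < k)` at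
size `N` and temperature `T` is `> 0`.

Proof (glue of landed fixed-`N` theory). At size `N ≤ k` every cell below `N` is switched on, so by
locality (`cellChain_isResponseCoeff_congr`, `cellChain_const_true`) `D` is a response coefficient of
the conjunct's homogeneous chain `pinnedChain ω₂ lam β γ` along some single-size steady-state family
`μ`. Weak steady states of the pinned chain are unique (`MatthiessenLadder.NessUnique_holds`) and exist
at every size (`pinnedChain_exists_isSteadyState`), so the canonical all-sizes family `μ₀` (choice, junk
`0` at non-positive bath temperatures) agrees with `μ` at size `N` for `0 < |δ| < 2T`; hence `D` is also
the size-`N` response coefficient of `μ₀` (uniqueness of limits along `𝓝[≠] 0`). The family `μ₀` has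
response coefficients `D' M` at every size (`FourierGreenKubo.finiteResponse_of_unique`), and these are
`> 0` for `M ≥ 2` (`FeketeSeriesLaw.PositiveConductance`, landed as
`…TwoScaleGluingLogRigidity.Stubs.stub_positiveConductance`); `D' N = D`.

No definitions, no named facts.
-/

noncomputable section

open MeasureTheory Filter Topology Set

namespace Summit.AtomisticToContinuum.FouriersLaw.Theorems.MatthiessenLadder.PrefixIncrementBoundsTop

open Literature.MathematicalPhysics.KineticTheory.HeatConduction
open Summit.AtomisticToContinuum.FouriersLaw.Theses.MatthiessenLadder

/-- **Stub `stub_positiveConductance_top` — positive conductance of the top rung.** For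
`ω₂, lam, β, γ > 0`, `T > 0`, `2 ≤ N ≤ k`: every response coefficient `D` of `cellChain (· < k)` at
`(N, T)` is `> 0`. At size `N ≤ k` the chain IS `pinnedChain ω₂ lam β γ` (locality); by weak-NESS
uniqueness the given single-size family agrees near equilibrium with the canonical all-sizes family,
whose response coefficients exist at every size (open-chain Green–Kubo) and are strictly positive for
`N ≥ 2` (non-degenerate tap energy of the Kubo corrector).
[cite: KunduDharNarayan2009, (reln2)–(reln3)] [cite: CuneoEckmannHairerReyBellet2018, Thm 2.13] -/
theorem stub_positiveConductance_top :
    ∀ ω₂ lam β γ : ℝ, 0 < ω₂ → 0 < lam → 0 < β → 0 < γ → ∀ T : ℝ, 0 < T →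
    ∀ N k : ℕ, 2 ≤ N → N ≤ k → ∀ D : ℝ,
      (cellChain ω₂ lam β γ (fun i => decide (i < k))).IsResponseCoeff N T D → 0 < D := by
  intro ω₂ lam β γ hω hl hβ hγ T hT N k hN2 hNk D hD
  -- Step 1 (locality): at size `N ≤ k` the prefix chain is the conjunct's pinned chain
  rw [cellChain_isResponseCoeff_congr ω₂ lam β γ (c' := fun _ => true)
      (fun i hi => by simp [lt_of_lt_of_le hi hNk]), cellChain_const_true] at hD
  obtain ⟨μ, hμ, hlim⟩ := hD
  simp only [OscillatorChain.toSiteChain_isSteadyState] at hμ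
  simp only [OscillatorChain.toSiteChain_totalCurrent] at hlim
  -- Step 2: weak-NESS uniqueness of the pinned chain at all sizes
  have hU := Summit.AtomisticToContinuum.FouriersLaw.Theses.MatthiessenLadder.NessUnique_holds
    ω₂ lam β γ hω hl hβ hγ
  -- Step 3: the canonical all-sizes steady-state family (choice; junk `0` at non-positive temperatures)
  have hex : ∀ (M : ℕ) (T_L T_R : ℝ), 0 < T_L → 0 < T_R →
      ∃ ν : Measure (PhaseSpace M), (pinnedChain ω₂ lam β γ).IsSteadyState M T_L T_R ν :=
    fun M T_L T_R h1 h2 => pinnedChain_exists_isSteadyState hω hl hβ hγ M h1 h2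
  classical
  let μ₀ : (M : ℕ) → ℝ → ℝ → Measure (PhaseSpace M) := fun M T_L T_R =>
    if h : 0 < T_L ∧ 0 < T_R then Classical.choose (hex M T_L T_R h.1 h.2) else 0
  have hμ₀ : ∀ (M : ℕ) (T_L T_R : ℝ), 0 < T_L → 0 < T_R →
      (pinnedChain ω₂ lam β γ).IsSteadyState M T_L T_R (μ₀ M T_L T_R) := by
    intro M T_L T_R h1 h2
    have h12 : 0 < T_L ∧ 0 < T_R := ⟨h1, h2⟩
    simp only [μ₀, dif_pos h12]
    exact Classical.choose_spec (hex M T_L T_R h1 h2)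
  -- Step 4: response coefficients of the canonical family at every size
  have hDex : ∀ M : ℕ, ∃ D' : ℝ, Tendsto (fun δ : ℝ =>
      (pinnedChain ω₂ lam β γ).totalCurrent (μ₀ M (T + δ / 2) (T - δ / 2)) / δ)
      (𝓝[≠] 0) (𝓝 D') :=
    fun M => Summit.AtomisticToContinuum.FouriersLaw.Theorems.FourierGreenKubo.finiteResponse_of_unique
      ω₂ lam β γ hω hl hβ hγ hU μ₀ hμ₀ T hT M
  choose D' hD' using hDex
  -- at size `N` the canonical family agrees with `μ` for `0 < |δ| < 2T`, so its coefficient is `D`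
  have hDN : Tendsto (fun δ : ℝ =>
      (pinnedChain ω₂ lam β γ).totalCurrent (μ₀ N (T + δ / 2) (T - δ / 2)) / δ) (𝓝[≠] 0) (𝓝 D) := by
    have key : ∀ᶠ δ in 𝓝[≠] (0 : ℝ),
        (pinnedChain ω₂ lam β γ).totalCurrent (μ (T + δ / 2) (T - δ / 2)) / δ =
          (pinnedChain ω₂ lam β γ).totalCurrent (μ₀ N (T + δ / 2) (T - δ / 2)) / δ := by
      have h2 : ∀ᶠ δ in 𝓝 (0 : ℝ), δ < 2 * T := eventually_lt_nhds (by linarith)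
      have h2' : ∀ᶠ δ in 𝓝 (0 : ℝ), -(2 * T) < δ := eventually_gt_nhds (by linarith)
      filter_upwards [mem_nhdsWithin_of_mem_nhds h2, mem_nhdsWithin_of_mem_nhds h2'] with δ hlt hgt
      have ha : 0 < T + δ / 2 := by linarith
      have hb : 0 < T - δ / 2 := by linarith
      rw [hU N _ _ ha hb _ _ (hμ _ _ ha hb) (hμ₀ N _ _ ha hb)]
    exact hlim.congr' key
  -- Step 5: positive conductance of the pinned chain at every size `≥ 2`, read off at size `N`
  have hpos : 0 < D' N :=
    Summit.AtomisticToContinuum.FouriersLaw.Cruxes.BoundedResponseConverges.TwoScaleGluingLogRigidity.Stubs.stub_positiveConductance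
      ω₂ lam β γ hω hl hβ hγ hU μ₀ hμ₀ T hT D' hD' N hN2
  have hEq : D' N = D := tendsto_nhds_unique (hD' N) hDN
  rwa [hEq] at hpos

end Summit.AtomisticToContinuum.FouriersLaw.Theorems.MatthiessenLadder.PrefixIncrementBoundsTop

end
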